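import Literature.NumberTheory.Automorphic.IdeleClassIntegration
import Literature.NumberTheory.Automorphic.TateTruncatedZetaCoefficientsLinear
import Mathlib.MeasureTheory.Group.Integral
import HarnessLib

/-!
# Unfolding a `Kˣ`-lattice sum over an idele class domain to a subgroup `H ⊇ Kˣ`

Topic `NumberTheory/Automorphic`; namespace `Literature.NumberTheory.Automorphic`. Proof file
(everything proved; no named fact). In the unipotent term of the trace formula for `U(3)`
[Rogawski1990, §7.3, (7.3.2)] the centre-lattice sum `Σ_{t ∈ F^*} ψ(t α₃(m)⁻¹ δ₀)` is integrated
over the image `N E^* ∖ N I_E ⊂ F^* ∖ I_F` of the torus, i.e. over `𝓕 ∩ H` for an idele class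
domain `𝓕` of `F` and the norm subgroup `H = F^* · N(I_E)` (of index two); unfolding the
`F^*`-sum gives the integral over `H` itself, which the index-two character `ω_{E/F}` splits as
`½ (∫_{I_F} + ∫_{I_F} ω)`. This file is that bookkeeping, for a general number field `K`, a
general subgroup `H ≤ 𝕀_K` containing the principal ideles, and a general left-invariant measure:

* (private) `tsum_indicator_comp_smul` — `Σ_k 1_H Φ (k • x) = 1_H (Σ_k Φ (k • ·)) x` (`Kˣ ≤ H`);
* `setLIntegral_inter_tsum_smul_eq_setLIntegral` — `∫⁻_{𝓕 ∩ H} Σ_{k ∈ Kˣ} u(k x) = ∫⁻_H u`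
  for measurable `u ≥ 0`;
* `setIntegral_inter_tsum_smul_eq_setIntegral` — the same for `Φ ∈ L¹(H)` (Bochner), and
  `integrableOn_inter_tsum_smul` — the lattice sum is integrable on `𝓕 ∩ H`;
* `setIntegral_subgroup_eq_half_add_half_mul` — `∫_H g = ½ ∫ g + ½ ∫ g ω` for `g ∈ L¹(𝕀_K)` and
  a function `ω = 1` on `H`, `= −1` off `H` (★ `setIntegral_inter_eq_half_add_half_mul` at
  `s = univ`);
* `integral_comp_inv_eq`, `setIntegral_comp_inv_eq_of_inv_mem_iff` — `y ↦ y⁻¹` in integrals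
  against a Haar measure of the (commutative) idele group, on all of `𝕀_K` or on an
  inversion-stable Borel set.

## References
* J. D. Rogawski, *Automorphic Representations of Unitary Groups in Three Variables* (1990),
  §7.3, (7.3.2) [Rogawski1990].
* G. B. Folland, *A Course in Abstract Harmonic Analysis* (1995), §2.6, Thm. 2.49 [Folland1995].
-/

set_option autoImplicit false
noncomputable section

open MeasureTheory Measure NumberField IsDedekindDomain Set Filter
open scoped ENNReal NNReal Pointwise Topology

namespace Literature.NumberTheory.Automorphic

variable {K : Type} [Field K] [NumberField K]

section Pointwise

variable {H : Subgroup (GaloisRepresentations.ideleGroup K)}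
  (hle : GaloisRepresentations.principalIdeles K ≤ H)

include hle in
/-- For `k ∈ Kˣ ≤ H`: `k • x ∈ H ↔ x ∈ H`. [folklore] -/
private theorem principalIdeles_smul_mem_subgroup_iff (k : GaloisRepresentations.principalIdeles K)
    (x : GaloisRepresentations.ideleGroup K) : k • x ∈ (H : Set (GaloisRepresentations.ideleGroup K)) ↔
      x ∈ (H : Set (GaloisRepresentations.ideleGroup K)) := by
  rw [Subgroup.smul_def, smul_eq_mul, SetLike.mem_coe, SetLike.mem_coe]
  exact ⟨fun h => by simpa using H.mul_mem (H.inv_mem (hle k.2)) h, fun h => H.mul_mem (hle k.2) h⟩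

include hle in
/-- `1_H Φ (k • x) = 1_H (Φ (k • ·)) x` for `k ∈ Kˣ ≤ H`. [folklore] -/
private theorem indicator_comp_smul {Z : Type*} [Zero Z] (Φ : GaloisRepresentations.ideleGroup K → Z)
    (k : GaloisRepresentations.principalIdeles K) (x : GaloisRepresentations.ideleGroup K) :
    (H : Set (GaloisRepresentations.ideleGroup K)).indicator Φ (k • x) =
      (H : Set (GaloisRepresentations.ideleGroup K)).indicator (fun x => Φ (k • x)) x := by
  by_cases hx : x ∈ (H : Set (GaloisRepresentations.ideleGroup K))
  · rw [indicator_of_mem hx, indicator_of_mem ((principalIdeles_smul_mem_subgroup_iff hle k x).2 hx)]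
  · rw [indicator_of_notMem hx, indicator_of_notMem (fun h =>
      hx ((principalIdeles_smul_mem_subgroup_iff hle k x).1 h))]

include hle in
/-- **`Σ_k 1_H Φ (k • x) = 1_H (Σ_k Φ (k • ·)) x`** for `Kˣ ≤ H` (topological sums in any
topological additive monoid). [folklore] -/
private theorem tsum_indicator_comp_smul {Z : Type*} [AddCommMonoid Z] [TopologicalSpace Z]
    (Φ : GaloisRepresentations.ideleGroup K → Z) (x : GaloisRepresentations.ideleGroup K) :
    ∑' k : GaloisRepresentations.principalIdeles K, (H : Set (GaloisRepresentations.ideleGroup K)).indicator Φ (k • x) =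
      (H : Set (GaloisRepresentations.ideleGroup K)).indicator
        (fun x => ∑' k : GaloisRepresentations.principalIdeles K, Φ (k • x)) x := by
  simp_rw [indicator_comp_smul hle]
  by_cases hx : x ∈ (H : Set (GaloisRepresentations.ideleGroup K))
  · simp only [indicator_of_mem hx]
  · simp only [indicator_of_notMem hx, tsum_zero]

end Pointwise

section Unfolding

variable [MeasurableSpace (GaloisRepresentations.ideleGroup K)] [BorelSpace (GaloisRepresentations.ideleGroup K)]
  (ν : Measure (GaloisRepresentations.ideleGroup K)) [ν.IsMulLeftInvariant]
  {𝓕 : Set (GaloisRepresentations.ideleGroup K)} {H : Subgroup (GaloisRepresentations.ideleGroup K)}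

/-- **Unfolding to `H`, `ℝ≥0∞` version.** For an idele class domain `𝓕`, a subgroup `H ⊇ Kˣ` with
Borel carrier, a left-invariant `ν` and a measurable `u ≥ 0`:
`∫⁻_{𝓕 ∩ H} Σ_{k ∈ Kˣ} u (k • x) dν = ∫⁻_H u dν`. [cite: Rogawski1990, §7.3 (7.3.2)]
[cite: Folland1995, §2.6 Thm. 2.49] -/
theorem setLIntegral_inter_tsum_smul_eq_setLIntegral (h𝓕 : IsIdeleClassDomain K 𝓕)
    (hle : GaloisRepresentations.principalIdeles K ≤ H)
    (hHm : MeasurableSet (H : Set (GaloisRepresentations.ideleGroup K)))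
    {u : GaloisRepresentations.ideleGroup K → ℝ≥0∞} (hu : Measurable u) :
    ∫⁻ x in 𝓕 ∩ (H : Set (GaloisRepresentations.ideleGroup K)),
        ∑' k : GaloisRepresentations.principalIdeles K, u (k • x) ∂ν =
      ∫⁻ x in (H : Set (GaloisRepresentations.ideleGroup K)), u x ∂ν := by
  calc ∫⁻ x in 𝓕 ∩ (H : Set (GaloisRepresentations.ideleGroup K)),
        ∑' k : GaloisRepresentations.principalIdeles K, u (k • x) ∂ν
      = ∫⁻ x in 𝓕, (H : Set (GaloisRepresentations.ideleGroup K)).indicator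
          (fun x => ∑' k : GaloisRepresentations.principalIdeles K, u (k • x)) x ∂ν := by
        rw [setLIntegral_indicator hHm, inter_comm]
    _ = ∫⁻ x in 𝓕, ∑' k : GaloisRepresentations.principalIdeles K,
          (H : Set (GaloisRepresentations.ideleGroup K)).indicator u (k • x) ∂ν := by
        simp_rw [tsum_indicator_comp_smul hle]
    _ = ∫⁻ x, (H : Set (GaloisRepresentations.ideleGroup K)).indicator u x ∂ν :=
        (lintegral_eq_setLIntegral_tsum_smul ν (h𝓕.isFundamentalDomain ν)
          (hu.indicator hHm).aemeasurable).symm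
    _ = ∫⁻ x in (H : Set (GaloisRepresentations.ideleGroup K)), u x ∂ν := lintegral_indicator hHm u

variable {E' : Type*} [NormedAddCommGroup E'] [NormedSpace ℝ E']

/-- **Unfolding to `H`, Bochner version.** For an idele class domain `𝓕`, a subgroup `H ⊇ Kˣ` with
Borel carrier, a left-invariant `ν` and `Φ ∈ L¹(H, ν)`:
`∫_{𝓕 ∩ H} Σ_{k ∈ Kˣ} Φ (k • x) dν = ∫_H Φ dν`. [cite: Rogawski1990, §7.3 (7.3.2)]
[cite: Folland1995, §2.6 Thm. 2.49] -/
theorem setIntegral_inter_tsum_smul_eq_setIntegral (h𝓕 : IsIdeleClassDomain K 𝓕)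
    (hle : GaloisRepresentations.principalIdeles K ≤ H)
    (hHm : MeasurableSet (H : Set (GaloisRepresentations.ideleGroup K)))
    {Φ : GaloisRepresentations.ideleGroup K → E'}
    (hΦ : IntegrableOn Φ (H : Set (GaloisRepresentations.ideleGroup K)) ν) :
    ∫ x in 𝓕 ∩ (H : Set (GaloisRepresentations.ideleGroup K)),
        ∑' k : GaloisRepresentations.principalIdeles K, Φ (k • x) ∂ν =
      ∫ x in (H : Set (GaloisRepresentations.ideleGroup K)), Φ x ∂ν := by
  calc ∫ x in 𝓕 ∩ (H : Set (GaloisRepresentations.ideleGroup K)),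
        ∑' k : GaloisRepresentations.principalIdeles K, Φ (k • x) ∂ν
      = ∫ x in 𝓕, (H : Set (GaloisRepresentations.ideleGroup K)).indicator
          (fun x => ∑' k : GaloisRepresentations.principalIdeles K, Φ (k • x)) x ∂ν :=
        (setIntegral_indicator hHm).symm
    _ = ∫ x in 𝓕, ∑' k : GaloisRepresentations.principalIdeles K,
          (H : Set (GaloisRepresentations.ideleGroup K)).indicator Φ (k • x) ∂ν := by
        simp_rw [tsum_indicator_comp_smul hle]
    _ = ∫ x, (H : Set (GaloisRepresentations.ideleGroup K)).indicator Φ x ∂ν :=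
        (integral_eq_setIntegral_tsum_smul ν (h𝓕.isFundamentalDomain ν)
          (hΦ.integrable_indicator hHm)).symm
    _ = ∫ x in (H : Set (GaloisRepresentations.ideleGroup K)), Φ x ∂ν := integral_indicator hHm

/-- **The lattice sum is integrable on `𝓕 ∩ H`** for a Borel `Φ ∈ L¹(H, ν)` (second countable
complete target, e.g. `ℂ`): `‖Σ_k Φ(k x)‖ ≤ Σ_k ‖Φ(k x)‖` and `∫_𝓕 Σ_k ‖1_H Φ (k x)‖ = ∫_H ‖Φ‖`.
[cite: Folland1995, §2.6 Thm. 2.49] -/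
theorem integrableOn_inter_tsum_smul (h𝓕 : IsIdeleClassDomain K 𝓕)
    (hle : GaloisRepresentations.principalIdeles K ≤ H)
    (hHm : MeasurableSet (H : Set (GaloisRepresentations.ideleGroup K)))
    {Φ : GaloisRepresentations.ideleGroup K → ℂ} (hΦm : Measurable Φ)
    (hΦ : IntegrableOn Φ (H : Set (GaloisRepresentations.ideleGroup K)) ν) :
    IntegrableOn (fun x => ∑' k : GaloisRepresentations.principalIdeles K, Φ (k • x))
      (𝓕 ∩ (H : Set (GaloisRepresentations.ideleGroup K))) ν := by
  haveI : MeasurableMul (GaloisRepresentations.ideleGroup K) := by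
    haveI := secondCountableTopology_ideleGroup K
    infer_instance
  set Ψ : GaloisRepresentations.ideleGroup K → ℂ := (H : Set (GaloisRepresentations.ideleGroup K)).indicator Φ with hΨ
  have hΨi : Integrable Ψ ν := hΦ.integrable_indicator hHm
  have hΨm : Measurable Ψ := hΦm.indicator hHm
  -- the lattice sum of `Ψ` is integrable on `𝓕`
  have hmeas : Measurable fun x => ∑' k : GaloisRepresentations.principalIdeles K, Ψ (k • x) := by
    refine Measurable.tsum fun k => ?_
    exact hΨm.comp (measurable_const_mul (k : GaloisRepresentations.ideleGroup K))
  have hS : IntegrableOn (fun x => ∑' k : GaloisRepresentations.principalIdeles K, Ψ (k • x)) 𝓕 ν := by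
    refine ⟨hmeas.aestronglyMeasurable, ?_⟩
    refine lt_of_le_of_lt (lintegral_mono fun x => enorm_tsum_le_tsum_enorm) ?_
    rw [← lintegral_eq_setLIntegral_tsum_smul ν (h𝓕.isFundamentalDomain ν) hΨm.enorm.aemeasurable]
    exact hΨi.2
  -- on `𝓕 ∩ H` it is the lattice sum of `Φ`
  refine (hS.mono_set inter_subset_left).congr_fun (fun x hx => ?_) (h𝓕.measurableSet.inter hHm)
  show ∑' k : GaloisRepresentations.principalIdeles K, Ψ (k • x) = ∑' k, Φ (k • x)
  rw [hΨ, tsum_indicator_comp_smul hle, indicator_of_mem hx.2]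

omit [NormedSpace ℝ E'] in
/-- **`∫⁻_{𝓕 ∩ H} Σ_k ‖Φ (k x)‖ₑ = ∫⁻_H ‖Φ‖ₑ`** — the finiteness transfer in the form used with
the Bochner bridge (`CoveringWeightsPushforwardBochner`). [cite: Folland1995, §2.6 Thm. 2.49] -/
theorem setLIntegral_inter_tsum_enorm_smul_eq (h𝓕 : IsIdeleClassDomain K 𝓕)
    (hle : GaloisRepresentations.principalIdeles K ≤ H)
    (hHm : MeasurableSet (H : Set (GaloisRepresentations.ideleGroup K)))
    {Φ : GaloisRepresentations.ideleGroup K → E'} (hΦm : AEStronglyMeasurable Φ ν) :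
    ∫⁻ x in 𝓕 ∩ (H : Set (GaloisRepresentations.ideleGroup K)),
        ∑' k : GaloisRepresentations.principalIdeles K, ‖Φ (k • x)‖ₑ ∂ν =
      ∫⁻ x in (H : Set (GaloisRepresentations.ideleGroup K)), ‖Φ x‖ₑ ∂ν := by
  calc ∫⁻ x in 𝓕 ∩ (H : Set (GaloisRepresentations.ideleGroup K)),
        ∑' k : GaloisRepresentations.principalIdeles K, ‖Φ (k • x)‖ₑ ∂ν
      = ∫⁻ x in 𝓕, (H : Set (GaloisRepresentations.ideleGroup K)).indicator
          (fun x => ∑' k : GaloisRepresentations.principalIdeles K, ‖Φ (k • x)‖ₑ) x ∂ν := by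
        rw [setLIntegral_indicator hHm, inter_comm]
    _ = ∫⁻ x in 𝓕, ∑' k : GaloisRepresentations.principalIdeles K,
          (H : Set (GaloisRepresentations.ideleGroup K)).indicator (fun x => ‖Φ x‖ₑ) (k • x) ∂ν := by
        simp_rw [tsum_indicator_comp_smul hle]
    _ = ∫⁻ x, (H : Set (GaloisRepresentations.ideleGroup K)).indicator (fun x => ‖Φ x‖ₑ) x ∂ν :=
        (lintegral_eq_setLIntegral_tsum_smul ν (h𝓕.isFundamentalDomain ν)
          ((hΦm.enorm.indicator hHm))).symm
    _ = ∫⁻ x in (H : Set (GaloisRepresentations.ideleGroup K)), ‖Φ x‖ₑ ∂ν := lintegral_indicator hHm _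

end Unfolding

section IndexTwo

variable [MeasurableSpace (GaloisRepresentations.ideleGroup K)]
  (ν : Measure (GaloisRepresentations.ideleGroup K)) {H : Set (GaloisRepresentations.ideleGroup K)}

/-- **Index-two split on the whole group**: if `ω = 1` on `H` and `ω = −1` off `H`, then for
`g ∈ L¹(𝕀_K, ν)`, `∫_H g = ½ ∫ g + ½ ∫ g·ω` (★ `setIntegral_inter_eq_half_add_half_mul` at
`s = univ`; for the norm subgroup `H = Kˣ·N(I_L)` of a quadratic `L/K` and `ω = ω_{L/K}` this is
the `½ Σ_{χ ∈ {1, ω}}` of [Rogawski1990, Prop. 7.3.2 (c), (d)]). [cite: Rogawski1990, §7.3 Prop. 7.3.2] -/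
theorem setIntegral_eq_half_add_half_mul_of_integrable (hH : MeasurableSet H)
    (ω : GaloisRepresentations.ideleGroup K → ℂ) (hω₁ : ∀ x ∈ H, ω x = 1) (hω₂ : ∀ x ∉ H, ω x = -1)
    {g : GaloisRepresentations.ideleGroup K → ℂ} (hg : Integrable g ν) :
    ∫ x in H, g x ∂ν = (1 / 2 : ℂ) * ∫ x, g x ∂ν + (1 / 2 : ℂ) * ∫ x, g x * ω x ∂ν := by
  have h := setIntegral_inter_eq_half_add_half_mul ν hH ω hω₁ hω₂ (s := univ) hg.integrableOn
  rwa [univ_inter, Measure.restrict_univ] at h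

end IndexTwo

section Inversion

variable [MeasurableSpace (GaloisRepresentations.ideleGroup K)] [BorelSpace (GaloisRepresentations.ideleGroup K)]
  (ν : Measure (GaloisRepresentations.ideleGroup K)) [ν.IsHaarMeasure]
  {E' : Type*} [NormedAddCommGroup E'] [NormedSpace ℝ E']

/-- A Haar measure of the (commutative, second countable, locally compact) idele group is
inversion invariant. [folklore] -/
private theorem isInvInvariant_idele : ν.IsInvInvariant := by
  haveI := locallyCompactSpace_ideleGroup K
  haveI := secondCountableTopology_ideleGroup K
  haveI := t2Space_ideleGroup K
  infer_instance

/-- **`∫ Φ(y⁻¹) dν(y) = ∫ Φ dν`** for a Haar measure of `𝕀_K`. [cite: Folland1995, §2.6 Thm. 2.49] -/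
theorem integral_comp_inv_eq (Φ : GaloisRepresentations.ideleGroup K → E') :
    ∫ y, Φ y⁻¹ ∂ν = ∫ y, Φ y ∂ν := by
  haveI := isInvInvariant_idele ν
  exact integral_inv_eq_self Φ ν

/-- **`∫_S Φ(y⁻¹) dν(y) = ∫_S Φ dν`** for a Haar measure of `𝕀_K` and an inversion-stable Borel
set `S` (e.g. a subgroup). [cite: Folland1995, §2.6 Thm. 2.49] -/
theorem setIntegral_comp_inv_eq_of_inv_mem_iff {S : Set (GaloisRepresentations.ideleGroup K)}
    (hS : MeasurableSet S) (hinv : ∀ y, y⁻¹ ∈ S ↔ y ∈ S) (Φ : GaloisRepresentations.ideleGroup K → E') :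
    ∫ y in S, Φ y⁻¹ ∂ν = ∫ y in S, Φ y ∂ν := by
  have h := integral_comp_inv_eq ν (S.indicator Φ)
  have hpt : (fun y => S.indicator Φ y⁻¹) = S.indicator fun y => Φ y⁻¹ := by
    funext y
    by_cases hy : y ∈ S
    · rw [indicator_of_mem hy, indicator_of_mem ((hinv y).2 hy)]
    · rw [indicator_of_notMem hy, indicator_of_notMem (fun h' => hy ((hinv y).1 h'))]
  rw [hpt, integral_indicator hS, integral_indicator hS] at h
  exact h

end Inversion

end Literature.NumberTheory.Automorphic
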